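import Literature.NumberTheory.Sieve.SmoothMajorantFinal
import Literature.Combinatorics.Additive.RelativeSzemerediProofs
import HarnessLib

/-!
# Green–Tao's Theorem 1.1 from Szemerédi's theorem, the dense model theorem and the counting lemma

Trunk T-SIEVE. The front door of the Conlon–Fox–Zhao route to B. Green, T. Tao, *The primes
contain arbitrarily long arithmetic progressions*, Ann. of Math. 167 (2008), Thm. 1.1 (the named
fact `Literature.NumberTheory.Sieve.exists_prime_arithmetic_progression` of `ParityWave0.lean`), as decomposed in this
tree along D. Conlon, J. Fox, Y. Zhao, *The Green–Tao theorem: an exposition*, EMS Surv. Math.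
Sci. 1 (2014): everything analytic (§§8–9: the smooth majorant and its linear forms estimate,
`smoothLinearFormsEstimate_holds`; Green–Tao's §9 reductions and the W-trick) and the §7 assembly
of the relative Szemerédi theorem (`Literature.Combinatorics.Additive.CFZ.relativeSzemeredi_of`) being proved, Theorem 1.1 rests
on exactly three named facts:

* `Literature.NumberTheory.Sieve.GreenTao2008.SzemerediExpectation` — Szemerédi's theorem in expectation form (Green–Tao
  Prop. 2.3 = CFZ Thm. 4.1);
* `Literature.Combinatorics.Additive.CFZ.DenseModel` — the dense model theorem (CFZ Thm. 5.1);
* `Literature.Combinatorics.Additive.CFZ.RelativeCounting` — the relative simplex counting lemma (CFZ Thm. 6.5).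

When these are discharged, `exists_prime_arithmetic_progression_holds` is the displayed term.

## References
* B. Green, T. Tao, Ann. of Math. 167 (2008), 481–547, Thm. 1.1. [cite: GreenTaoAnnals2008]
* D. Conlon, J. Fox, Y. Zhao, EMS Surv. Math. Sci. 1 (2014), 249–282, Thm. 1.1 via Thm. 4.3,
  Prop. 8.1, §7. [cite: ConlonFoxZhao2014]
-/

/-- **Green–Tao, Theorem 1.1, from Szemerédi's theorem (expectation form), the dense model theorem
and the relative counting lemma**: the composite of the tree's
`Literature.NumberTheory.Sieve.exists_prime_arithmetic_progression_of_relativeSzemeredi` (Conlon–Fox–Zhao Thm. 1.1 via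
Thm. 4.3 and the proved Prop. 8.3) with `Literature.Combinatorics.Additive.CFZ.relativeSzemeredi_of` (CFZ §7: Thm. 4.3 from
Thms. 4.1, 5.1, 6.5). [cite: ConlonFoxZhao2014, Theorem 1.1 (proof via Theorems 4.1, 4.3, 5.1, 6.5 and Proposition 8.1)]
[cite: GreenTaoAnnals2008, Theorem 1.1] -/
theorem Literature.NumberTheory.Sieve.exists_prime_arithmetic_progression_of_szemeredi
    (h41 : Literature.NumberTheory.Sieve.GreenTao2008.SzemerediExpectation) (h51 : Literature.Combinatorics.Additive.CFZ.DenseModel)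
    (h65 : Literature.Combinatorics.Additive.CFZ.RelativeCounting) : Literature.NumberTheory.Sieve.exists_prime_arithmetic_progression :=
  Literature.NumberTheory.Sieve.exists_prime_arithmetic_progression_of_relativeSzemeredi (Literature.Combinatorics.Additive.CFZ.relativeSzemeredi_of h41 h51 h65)
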